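import Mathlib.RingTheory.Valuation.ValuationSubring
import Mathlib.RingTheory.Valuation.RankOne
import Mathlib.RingTheory.RegularLocalRing.Defs
import Mathlib.RingTheory.Localization.AtPrime.Basic
import Mathlib.RingTheory.Localization.FractionRing
import Mathlib.RingTheory.Adjoin.FG
import HarnessLib

/-!
# Reduction of local uniformization to rank-one valuations (Novacoski–Spivakovsky 2014)

Topic: `Literature/AlgebraicGeometry/Resolution`. One named fact filed by a grounder for route
`ResolutionOfSingularities/Valuative` (items `stmt-ResolutionOfSingularities-0644`, `-0563`).

## Content

* `RelLocalUniformization k K O` — **relative Zariski local uniformization** of the valuation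
  ring `O` of `K` over the base field `k`, in the commutative-algebra wording used by the route:
  every finitely generated `k`-subalgebra `R ⊆ O` with `Frac R = K` is contained in a finitely
  generated `k`-subalgebra `A ⊆ O` whose localisation at the centre `m_O ∩ A` is a regular local
  ring. This is Novacoski–Spivakovsky's Local Uniformization Property (Def. 2.20) for the
  valuation `ν_O` centred at the local ring `R_{m_O ∩ R}`: a finite sequence of local blowing ups
  (Def. 2.8: `R ↦ R[a₁/b₁,…,a_r/b_r]` with `ν(b_i) ≤ ν(a_i)`, localised at the centre) ending in
  a regular local ring composes to `A_{m_O ∩ A}` for the finitely generated `A = R[all a_i/b_i]`,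
  and conversely one such `A` is one local blowing up along an ideal (Def. 2.11).
* `NovacoskiSpivakovsky2014` — NAMED FACT, Thm. 1.1 of the paper with the category
  `M = {local rings essentially of finite type over k}` (closed under homomorphic images,
  finitely generated birational extensions and localisations, as Thm. 1.1 requires): if every
  RANK-ONE valuation ring admits relative local uniformization then every valuation ring does.

## Source

* J. Novacoski, M. Spivakovsky, *Reduction of local uniformization to the rank one case*,
  Proc. of the Second International Conference on Valuation Theory (Segovia–El Escorial 2011),
  EMS Ser. Congr. Rep. (2014); arXiv:1204.4751v1: Thm. 1.1 (p. 2), Def. 2.8 (p. 6), Def. 2.11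
  (p. 8), Def. 2.20 (p. 13).

## Design choices

* Pure commutative algebra over Mathlib's `ValuationSubring` / `Subalgebra` / `Localization.AtPrime`
  / `IsRegularLocalRing`, exactly the shape of the route's items (no schemes).
* Rank one = Mathlib `Valuation.RankOne` on `O.valuation` (value group embeds in `ℝ≥0`,
  nontrivially), as in the items.
* `k ⊆ O` is automatic from `R ≤ O`; `Frac R = K` (`IsFractionRing R K`) says `ν_O` is a valuation
  of `Quot(R)`, as in Def. 2.20.
-/

noncomputable section

namespace Literature.AlgebraicGeometry.Resolution

/-- **Relative local uniformization** of a valuation ring `O` of `K` over `k`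
(Novacoski–Spivakovsky 2014, Def. 2.20 for `ν_O` centred at `R_{m_O ∩ R}`, `R` running over the
finitely generated `k`-subalgebras of `O` with fraction field `K`; see the module docstring for
the translation of "sequence of local blowing ups"). [cite: NovacoskiSpivakovsky2014, Def. 2.20] -/
def RelLocalUniformization (k K : Type) [Field k] [Field K] [Algebra k K]
    (O : ValuationSubring K) : Prop :=
  ∀ R : Subalgebra k K, R.FG → IsFractionRing R K → R.toSubring ≤ O.toSubring →
    ∃ (A : Subalgebra k K) (h : A.toSubring ≤ O.toSubring), R ≤ A ∧ A.FG ∧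
      IsRegularLocalRing
        (Localization.AtPrime (Ideal.comap (Subring.inclusion h) (IsLocalRing.maximalIdeal O)))

/-- NAMED FACT — **Novacoski–Spivakovsky 2014, Thm. 1.1** ("Assume that for every Noetherian
local ring `(R, m)` in `M`, every rank one valuation centered in `(R, m)` admits local
uniformization. Then all the valuations centered in members of `M` admit local
uniformization."), for `M` = local rings essentially of finite type over the field `k`: if
`RelLocalUniformization k K O` holds for every field `K ⊇ k` and every rank-one valuation ring
`O` of `K`, then it holds for every valuation ring. Users take `(h : NovacoskiSpivakovsky2014)`.
[cite: NovacoskiSpivakovsky2014, Thm. 1.1] -/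
def NovacoskiSpivakovsky2014 : Prop :=
  ∀ (k : Type) [Field k],
    (∀ (K : Type) [Field K] [Algebra k K] (O : ValuationSubring K),
      Nonempty O.valuation.RankOne → RelLocalUniformization k K O) →
    ∀ (K : Type) [Field K] [Algebra k K] (O : ValuationSubring K), RelLocalUniformization k K O

end Literature.AlgebraicGeometry.Resolution

end
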